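import Summits.Ventures.HSemireg.WedgeApolarSiegelWindowCharP
import Mathlib.Data.Nat.Digits.Defs

/-!
# Venture HSemireg — FINE's COUNT FOR TH-7's SIEGEL CLASSES: the number of `j ≤ n` with `p ∤ C(n,j)` is `Π_i (n_i + 1)` over the base-`p` digits `n_i` of `n` (typed here from
# Lucas's digit criterion of J2 by the digit-shift bijection `j ↦ (⌊j/p⌋, j mod p)`), hence in characteristic `p`
# `dim (coSiegel_n ⊓ SI_n) = (n + 1) − Π_i (n_i + 1)` — the exact dimension of the space of Siegel classes for EVERY `n`

HONEST FRAMING. Part of the Lean index of the computation cell `pub-hsemireg` (seat p10 gen 20, Sunday typer «UNIFORM-IN-n»).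
Finite-dimensional EXTERIOR ALGEBRA + elementary arithmetic of binomial coefficients ONLY: no variety, no cohomology theory, no sheaf, no Ext group, no semiregularity map;
nothing here says that HC / HC_CM / HC_AV holds; no Literature fact is declared or used (the count is PROVED here from J2's Lucas criterion; it is the classical statement usually
attributed to N. J. Fine (1947), quoted for orientation only).  Custodian versions as in `WedgeHankelSiegelIdeal` (1/3) and `WedgeHankelCoSiegel`.

WHAT IS IN THE TREE.  I19 `finrank_coSiegel_inf_siegelIdeal` (`= #{j ≤ n : C(n,j) = 0 in K}`); J2 (`WedgeApolarSiegelWindowCharP`): `prime_dvd_choose_iff_exists_digit_lt`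
(`p ∣ C(n,j) ⇔ ∃ i, n_i < j_i`), the prime-power count `p^e − 1`; J2 «NOT typed: the closed count `(n+1) − Π_i (n_i + 1)`».  THIS FILE (namespace `Summit.Ventures.HSemireg.Wedge.KernelDuality`
continued; imports J2 + `Mathlib.Data.Nat.Digits.Defs`) types it:
* §257 the digit-shift bijection: `digit_zero_eq_mod`, `digit_succ_eq_digit_div`, **`filter_digit_le_eq_image`** (`{j ≤ n : j ≼ n digitwise} = {p·a + s : a ≼ ⌊n/p⌋ digitwise, s ≤ n mod p}`),
  `mul_add_injOn`, **`card_filter_digit_le`: `#{j ≤ n : ∀ i, j_i ≤ n_i} = Π_i (n_i + 1)`** (`((Nat.digits p n).map (· + 1)).prod`, every `p ≥ 2`, every `n`).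
* §258 **`card_filter_not_prime_dvd_choose`: `#{j ≤ n : p ∤ C(n,j)} = Π_i (n_i + 1)`** (FINE's theorem, from J2's Lucas criterion), `prod_digits_succ_le` (`Π_i (n_i+1) ≤ n+1`).
* §259 in characteristic `p`: `finrank_coSiegel_inf_siegelIdeal_eq_card_filter_dvd` (`dim = #{j ≤ n : p ∣ C(n,j)}`), **`finrank_coSiegel_inf_siegelIdeal_eq_sub_prod_digits`:
  `dim (coSiegel_n ⊓ SI_n) = (n + 1) − Π_i (n_i + 1)`**, and `coSiegel_inf_siegelIdeal_eq_bot_iff_prod_digits` (`= ⊥ ⇔ Π_i (n_i+1) = n+1`).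
NOT typed here: the reading «`Π(n_i+1) = n+1` iff all digits of `n` below the top are `p − 1`»; anything Ext-side.  New names only.
-/

open Module

namespace Summit.Ventures.HSemireg.Wedge.KernelDuality

open Summit.Ventures.HSemireg.Wedge Summit.Ventures.HSemireg.Wedge.Kunneth Summit.Ventures.HSemireg.Wedge.Hankel
  Summit.Ventures.HSemireg.Wedge.BasisFree Summit.Ventures.HSemireg.Wedge.HankelSiegel Summit.Ventures.HSemireg.Wedge.HankelSiegelIdeal
  Summit.Ventures.HSemireg.Wedge.KunnethKernel Summit.Ventures.HSemireg.Wedge.HankelRankOne Summit.Ventures.HSemireg.Wedge.HankelFrameChange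

variable (K : Type*) [Field K] {n : ℕ}

/-! ## §257. The digit-shift bijection and the count `Π_i (n_i + 1)` -/

section Digits

variable {p : ℕ}

/-- the `0`-th digit is the residue. -/
theorem digit_zero_eq_mod (j : ℕ) : j / p ^ 0 % p = j % p := by rw [pow_zero, Nat.div_one]

/-- the `(i+1)`-st digit of `j` is the `i`-th digit of `⌊j/p⌋`. -/
theorem digit_succ_eq_digit_div (j i : ℕ) : j / p ^ (i + 1) % p = j / p / p ^ i % p := by
  rw [pow_succ', ← Nat.div_div_eq_div_mul]

/-- `(a, s) ↦ p·a + s` is injective on pairs with `s < p`. -/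
theorem mul_add_injOn (hp : 2 ≤ p) (m r : ℕ) (hr : r < p) :
    Set.InjOn (fun x : ℕ × ℕ => p * x.1 + x.2) ↑((Finset.range (m + 1)) ×ˢ (Finset.range (r + 1))) := by
  rintro ⟨a, s⟩ hx ⟨a', s'⟩ hx' h
  simp only [Finset.coe_product, Set.mem_prod, Finset.mem_coe, Finset.mem_range] at hx hx'
  simp only at h
  have hs : s < p := by omega
  have hs' : s' < p := by omega
  have h1 : (p * a + s) % p = (p * a' + s') % p := by rw [h]
  rw [Nat.mul_add_mod, Nat.mul_add_mod, Nat.mod_eq_of_lt hs, Nat.mod_eq_of_lt hs'] at h1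
  subst h1
  have h2 : p * a = p * a' := by omega
  have ha : a = a' := Nat.eq_of_mul_eq_mul_left (by omega) h2
  subst ha
  rfl

open Classical in
/-- **THE DIGIT-SHIFT BIJECTION: `{j ≤ n : j ≼ n digitwise} = {p·a + s : a ≤ ⌊n/p⌋, a ≼ ⌊n/p⌋ digitwise, s ≤ n mod p}`** (the digitwise predicate quantifies over all positions,
so the filters use classical decidability). -/
theorem filter_digit_le_eq_image (hp : 2 ≤ p) (n : ℕ) :
    (Finset.range (n + 1)).filter (fun j => ∀ i, j / p ^ i % p ≤ n / p ^ i % p) =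
      (((Finset.range (n / p + 1)).filter (fun a => ∀ i, a / p ^ i % p ≤ n / p / p ^ i % p)) ×ˢ (Finset.range (n % p + 1))).image
        (fun x : ℕ × ℕ => p * x.1 + x.2) := by
  ext j
  simp only [Finset.mem_filter, Finset.mem_range, Finset.mem_image, Finset.mem_product, Prod.exists]
  constructor
  · rintro ⟨hj, hd⟩
    refine ⟨j / p, j % p, ⟨⟨?_, fun i => ?_⟩, ?_⟩, Nat.div_add_mod j p⟩
    · exact Nat.lt_succ_of_le (Nat.div_le_div_right (Nat.le_of_lt_succ hj))
    · have h := hd (i + 1)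
      rwa [digit_succ_eq_digit_div, digit_succ_eq_digit_div] at h
    · have h := hd 0
      rw [digit_zero_eq_mod, digit_zero_eq_mod] at h
      omega
  · rintro ⟨a, s, ⟨⟨ha, had⟩, hs⟩, rfl⟩
    have hsp : s < p := lt_of_le_of_lt (Nat.le_of_lt_succ hs) (Nat.mod_lt n (by omega))
    have hdiv : (p * a + s) / p = a := by rw [Nat.mul_add_div (by omega), Nat.div_eq_of_lt hsp, add_zero]
    have hmod : (p * a + s) % p = s := by rw [Nat.mul_add_mod, Nat.mod_eq_of_lt hsp]
    refine ⟨?_, fun i => ?_⟩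
    · -- `p·a + s ≤ p·⌊n/p⌋ + n mod p = n`
      have ha' : a ≤ n / p := Nat.le_of_lt_succ ha
      have hn : p * (n / p) + n % p = n := Nat.div_add_mod n p
      have : p * a + s ≤ p * (n / p) + n % p := add_le_add (Nat.mul_le_mul_left p ha') (Nat.le_of_lt_succ hs)
      omega
    · rcases i with _ | i
      · rw [digit_zero_eq_mod, digit_zero_eq_mod, hmod]; exact Nat.le_of_lt_succ hs
      · rw [digit_succ_eq_digit_div, digit_succ_eq_digit_div, hdiv]; exact had i

open Classical in
/-- **`#{j ≤ n : ∀ i, j_i ≤ n_i} = Π_i (n_i + 1)`** over the base-`p` digits of `n` (`p ≥ 2`; strong induction on `n` through the digit-shift bijection). -/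
theorem card_filter_digit_le (hp : 2 ≤ p) : ∀ n : ℕ,
    ((Finset.range (n + 1)).filter (fun j => ∀ i, j / p ^ i % p ≤ n / p ^ i % p)).card = ((Nat.digits p n).map (· + 1)).prod := by
  intro n
  induction n using Nat.strong_induction_on with
  | _ n ih =>
    rcases Nat.eq_zero_or_pos n with rfl | hn
    · -- `n = 0`: only `j = 0`
      rw [Nat.digits_zero, List.map_nil, List.prod_nil]
      have h : (Finset.range (0 + 1)).filter (fun j => ∀ i, j / p ^ i % p ≤ 0 / p ^ i % p) = {0} := by
        ext j
        simp only [Finset.mem_filter, Finset.mem_range, zero_add, Nat.lt_one_iff, Finset.mem_singleton, Nat.zero_div, Nat.zero_mod, Nat.le_zero]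
        constructor
        · exact fun h => h.1
        · rintro rfl; exact ⟨rfl, fun i => by rw [Nat.zero_div, Nat.zero_mod]⟩
      rw [h, Finset.card_singleton]
    · rw [Nat.digits_of_two_le_of_pos hp hn, List.map_cons, List.prod_cons, filter_digit_le_eq_image hp n,
        Finset.card_image_of_injOn, Finset.card_product, Finset.card_range, ih (n / p) (Nat.div_lt_self hn (by omega)), mul_comm]
      -- injectivity on the product (second coordinates `< p`)
      intro x hx y hy h
      have hx' : x ∈ (Finset.range (n / p + 1)) ×ˢ (Finset.range (n % p + 1)) := by
        simp only [Finset.coe_product, Set.mem_prod, Finset.mem_coe, Finset.mem_filter] at hx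
        exact Finset.mem_product.mpr ⟨hx.1.1, hx.2⟩
      have hy' : y ∈ (Finset.range (n / p + 1)) ×ˢ (Finset.range (n % p + 1)) := by
        simp only [Finset.coe_product, Set.mem_prod, Finset.mem_coe, Finset.mem_filter] at hy
        exact Finset.mem_product.mpr ⟨hy.1.1, hy.2⟩
      exact mul_add_injOn hp (n / p) (n % p) (Nat.mod_lt n (by omega)) (Finset.mem_coe.mpr hx') (Finset.mem_coe.mpr hy') h

/-! ## §258. Fine's count -/

/-- **FINE's COUNT: `#{j ≤ n : p ∤ C(n,j)} = Π_i (n_i + 1)`** for a prime `p` (J2's Lucas criterion `p ∣ C(n,j) ⇔ ∃ i, n_i < j_i` + §257). -/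
theorem card_filter_not_prime_dvd_choose (hp : p.Prime) (n : ℕ) :
    ((Finset.range (n + 1)).filter (fun j => ¬ p ∣ n.choose j)).card = ((Nat.digits p n).map (· + 1)).prod := by
  classical
  rw [← card_filter_digit_le hp.two_le n]
  congr 1
  refine Finset.filter_congr fun j _ => ?_
  rw [prime_dvd_choose_iff_exists_digit_lt hp, not_exists]
  exact forall_congr' fun i => not_lt

/-- `Π_i (n_i + 1) ≤ n + 1`. -/
theorem prod_digits_succ_le (hp : p.Prime) (n : ℕ) : ((Nat.digits p n).map (· + 1)).prod ≤ n + 1 := by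
  rw [← card_filter_not_prime_dvd_choose hp n]
  exact (Finset.card_filter_le _ _).trans (Finset.card_range (n + 1)).le

end Digits

/-! ## §259. The exact dimension of the space of Siegel classes in characteristic `p` -/

/-- in characteristic `p`: `dim (coSiegel_n ⊓ SI_n) = #{j ≤ n : p ∣ C(n,j)}` (I19 `finrank_coSiegel_inf_siegelIdeal`, counted over `range (n+1)`). -/
theorem finrank_coSiegel_inf_siegelIdeal_eq_card_filter_dvd (p : ℕ) [CharP K p] :
    finrank K ↥(coSiegel K n n ⊓ siegelIdeal K n n) = ((Finset.range (n + 1)).filter (fun j => p ∣ n.choose j)).card := by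
  classical
  rw [finrank_coSiegel_inf_siegelIdeal, Nat.card_eq_fintype_card, Fintype.card_subtype]
  have hmap : (Finset.univ.filter fun q : Fin (n + 1) => ((n.choose (q : ℕ) : K) = 0)).map Fin.valEmbedding =
      (Finset.range (n + 1)).filter (fun j => p ∣ n.choose j) := by
    ext j
    simp only [Finset.mem_map, Finset.mem_filter, Finset.mem_univ, true_and, Fin.valEmbedding_apply, Finset.mem_range, CharP.cast_eq_zero_iff K p]
    constructor
    · rintro ⟨q, hq, rfl⟩; exact ⟨q.2, hq⟩
    · rintro ⟨hj, hd⟩; exact ⟨⟨j, hj⟩, hd, rfl⟩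
  rw [← Finset.card_map Fin.valEmbedding, hmap]

/-- **THE EXACT DIMENSION OF THE SIEGEL CLASSES IN CHARACTERISTIC `p`: `dim (coSiegel_n ⊓ SI_n) = (n + 1) − Π_i (n_i + 1)`** over the base-`p` digits `n_i` of `n` (every `n`;
J2's prime-power count `p^e − 1` is the case `digits = [0, …, 0, 1]`). -/
theorem finrank_coSiegel_inf_siegelIdeal_eq_sub_prod_digits (p : ℕ) [CharP K p] (hp : p.Prime) :
    finrank K ↥(coSiegel K n n ⊓ siegelIdeal K n n) = (n + 1) - ((Nat.digits p n).map (· + 1)).prod := by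
  rw [finrank_coSiegel_inf_siegelIdeal_eq_card_filter_dvd K p, ← card_filter_not_prime_dvd_choose hp n]
  have h := Finset.card_filter_add_card_filter_not (s := Finset.range (n + 1)) (fun j => p ∣ n.choose j)
  rw [Finset.card_range] at h
  omega

/-- **`coSiegel_n ⊓ SI_n = ⊥` in characteristic `p` iff `Π_i (n_i + 1) = n + 1`** (iff no binomial `C(n,j)` dies). -/
theorem coSiegel_inf_siegelIdeal_eq_bot_iff_prod_digits (p : ℕ) [CharP K p] (hp : p.Prime) :
    coSiegel K n n ⊓ siegelIdeal K n n = ⊥ ↔ ((Nat.digits p n).map (· + 1)).prod = n + 1 := by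
  rw [← Submodule.finrank_eq_zero, finrank_coSiegel_inf_siegelIdeal_eq_sub_prod_digits K p hp]
  have h := prod_digits_succ_le hp n
  omega

end Summit.Ventures.HSemireg.Wedge.KernelDuality
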